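import Summits.CriticalPhenomena.PercolationContinuityZ3.Theorems.PercNearOneGluingNoHeavyLowerTailGroupThreePointLB
import Summits.CriticalPhenomena.PercolationContinuityZ3.Theorems.PercNearOneGluingNoHeavyLowerTailE3FourPointClassesAllGraphs
import HarnessLib

/-!
# `NoHeavyLowerTail` (stmt-CriticalPhenomena-4575) — `GRP3PTLB` in the E3GRP row vocabulary: four-point class `(b)` and the
# five-terminal rows `E3GRP` 1, 2, 3 and `E3GRPb` 1 hold on EVERY finite weighted graph

Support file (prover prim-ineq-prove-3, gen 5; `--supports stmt-CriticalPhenomena-4575`).  No definitions, no named facts, no sorries.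

`…GroupThreePointLB` proves `GroupThreePointLB.sahiE3_groupPairSep_nonneg`: Sahi's `E₃ ≥ 0` for the three pairwise separation
events of two vertex SETS and a vertex, on every finite weighted graph.  This file records its instances in the `sep`/`Row4Holds`/
`RowHolds` vocabulary of prim-cert-2's `…E3GroupSepLeFive` / `…E3FourPointClassesLeFive` (kernel certificates for `n ≤ 5`) and
`…E3FourPointClassesAllGraphs` (classes `F`, `(ii)` for all `n`; there "(b) still open on general graphs"):
* `sahiE3_sep_nonneg` — `0 ≤ E₃(D[X|Y], D[X|c], D[Y|c])` for all terminal LISTS `X, Y` and every vertex `c`, every `n`, `w`;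
* `rowHolds4_two_all` — four-point class `(b) = E₃(D[a|bc], D[a|y], D[bc|y]) ≥ 0` for every `n` (no distinctness needed);
* `rowHolds_zero_all`, `rowHolds_one_all`, `rowHolds_two_all` — the five-terminal rows `gen8g2-E3GRP` 1, 2, 3
  (`E3dec{[a1,a2]|[a3];[o,b]|[a1,a2];[o,b]|[a3]}`, `E3dec{[o]|[a1];[o]|[a2,a3];[a1]|[a2,a3]}`, `E3dec{[a1]|[a2,a3];[a1]|[b];[a2,a3]|[b]}`)
  for every `n`;
* `e3GRPb_one_all` — `gen8g2-E3GRPb` row 1 `E3dec{[o]|[a1,a2];[o]|[a3,b];[a1,a2]|[a3,b]}` for every `n`.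
Together with the harness relabellings these are all 65 "pairwise separations of three disjoint groups" cubic rows on five terminals
(this seat's request `P3-GRP3PTLB`; they cut the proved-cone survivors CM3-B and KNB2, FINDING-GRP3PTLB.md §0).
Still open on general graphs after this file: classes `(iii)`, `α`, `β`, `γ` beyond `AG⁺`, and rows `E3GRP` 4–9.
-/

noncomputable section

namespace Summit.CriticalPhenomena.PercolationContinuityZ3.Theorems

open MeasureTheory Set
open Literature.Probability.Percolation Literature.Probability.LatticeModels

namespace E3GroupSepCert

open CovTransferCert

variable {n : ℕ}

/-! ## Dictionary -/

/-- `D[X|Y]` as an intersection of pair separations over the finite sets of the lists. [this work] -/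
theorem connEvent_sep_eq_iInter (X Y : List (Fin n)) :
    connEvent (sep X Y) = ⋂ x ∈ X.toFinset, ⋂ y ∈ Y.toFinset, (openConn x y)ᶜ := by
  rw [connEvent_sep]
  ext ω
  simp only [mem_setOf_eq, mem_iInter, mem_compl_iff, List.mem_toFinset]

/-- `D[X|c] = ⋂_{x ∈ X} {x ↮ c}`. [this work] -/
theorem connEvent_sep_singleton_eq_iInter (X : List (Fin n)) (c : Fin n) :
    connEvent (sep X [c]) = ⋂ x ∈ X.toFinset, (openConn x c)ᶜ := by
  rw [connEvent_sep]
  ext ω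
  simp only [mem_setOf_eq, mem_iInter, mem_compl_iff, List.mem_toFinset, List.mem_singleton, forall_eq]

/-- `D[X|Y] = D[Y|X]`. [this work] -/
theorem connEvent_sep_comm (X Y : List (Fin n)) : connEvent (sep X Y) = connEvent (sep Y X) := by
  rw [connEvent_sep, connEvent_sep]
  ext ω
  simp only [mem_setOf_eq]
  constructor
  · intro h y hy x hx
    rw [KNPreFKG.openConn_symm]
    exact h x hx y hy
  · intro h x hx y hy
    rw [KNPreFKG.openConn_symm]
    exact h y hy x hx

/-! ## `GRP3PTLB` for terminal lists -/

/-- **`GRP3PTLB` in the `sep` vocabulary**: for all terminal lists `X, Y`, every vertex `c`, every `n` and `w`,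
`0 ≤ E₃(D[X|Y], D[X|c], D[Y|c])` (`GroupThreePointLB.sahiE3_groupPairSep_nonneg`). [this work] -/
theorem sahiE3_sep_nonneg (w : Sym2 (Fin n) → unitInterval) (X Y : List (Fin n)) (c : Fin n) :
    0 ≤ sahiE3 (prodBernoulli w) (connEvent (sep X Y)) (connEvent (sep X [c])) (connEvent (sep Y [c])) := by
  rw [connEvent_sep_eq_iInter, connEvent_sep_singleton_eq_iInter, connEvent_sep_singleton_eq_iInter]
  exact GroupThreePointLB.sahiE3_groupPairSep_nonneg w X.toFinset Y.toFinset c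

/-- The same with the vertex written first: `0 ≤ E₃(D[c|X], D[c|Y], D[X|Y])`. [this work] -/
theorem sahiE3_sep_nonneg' (w : Sym2 (Fin n) → unitInterval) (c : Fin n) (X Y : List (Fin n)) :
    0 ≤ sahiE3 (prodBernoulli w) (connEvent (sep [c] X)) (connEvent (sep [c] Y)) (connEvent (sep X Y)) := by
  have h := sahiE3_sep_nonneg w X Y c
  rw [connEvent_sep_comm X [c], connEvent_sep_comm Y [c], sahiE3_comm₁₂, sahiE3_comm₂₃] at h
  exact h

/-! ## Four-point class `(b)` and the five-terminal rows, every `n` -/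

/-- **Class `(b)` (row `2` of `row4`) on EVERY finite weighted graph**: `E₃(D[a|bc], D[a|y], D[bc|y]) ≥ 0` for all `n`, `w`,
`a b c y` — `GRP3PTLB` with `X = [a]`, `Y = [b, c]`, vertex `y`. [this work] -/
theorem rowHolds4_two_all (w : Sym2 (Fin n) → unitInterval) (a b c y : Fin n) : Row4Holds 2 w (a, b, c, y) := by
  have hr : row4 2 (a, b, c, y) = (sep [a] [b, c], sep [a] [y], sep [b, c] [y]) := rfl
  unfold Row4Holds
  rw [hr, e3Ineq_iff_sahiE3_nonneg]
  exact sahiE3_sep_nonneg w [a] [b, c] y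

/-- **Row `E3GRP` 1 (`row 0`) on EVERY finite weighted graph**: `E₃(D[a₁a₂|a₃], D[ob|a₁a₂], D[ob|a₃]) ≥ 0` — `GRP3PTLB` with
the sets `{o,b}`, `{a₁,a₂}` and the vertex `a₃`. [this work] -/
theorem rowHolds_zero_all (w : Sym2 (Fin n) → unitInterval) (o a₁ a₂ a₃ b : Fin n) : RowHolds 0 w (o, a₁, a₂, a₃, b) := by
  have hr : row 0 (o, a₁, a₂, a₃, b) = (sep [a₁, a₂] [a₃], sep [o, b] [a₁, a₂], sep [o, b] [a₃]) := rfl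
  unfold RowHolds
  rw [hr, e3Ineq_iff_sahiE3_nonneg]
  have h := sahiE3_sep_nonneg w [o, b] [a₁, a₂] a₃
  rw [sahiE3_comm₂₃, sahiE3_comm₁₂] at h
  exact h

/-- **Row `E3GRP` 2 (`row 1`) on EVERY finite weighted graph**: `E₃(D[o|a₁], D[o|a₂a₃], D[a₁|a₂a₃]) ≥ 0` — `GRP3PTLB` with the
vertex `o` and the sets `{a₁}`, `{a₂,a₃}`. [this work] -/
theorem rowHolds_one_all (w : Sym2 (Fin n) → unitInterval) (o a₁ a₂ a₃ b : Fin n) : RowHolds 1 w (o, a₁, a₂, a₃, b) := by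
  have hr : row 1 (o, a₁, a₂, a₃, b) = (sep [o] [a₁], sep [o] [a₂, a₃], sep [a₁] [a₂, a₃]) := rfl
  unfold RowHolds
  rw [hr, e3Ineq_iff_sahiE3_nonneg]
  exact sahiE3_sep_nonneg' w o [a₁] [a₂, a₃]

/-- **Row `E3GRP` 3 (`row 2`) on EVERY finite weighted graph**: `E₃(D[a₁|a₂a₃], D[a₁|b], D[a₂a₃|b]) ≥ 0` — `GRP3PTLB` with the
sets `{a₁}`, `{a₂,a₃}` and the vertex `b`. [this work] -/
theorem rowHolds_two_all (w : Sym2 (Fin n) → unitInterval) (o a₁ a₂ a₃ b : Fin n) : RowHolds 2 w (o, a₁, a₂, a₃, b) := by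
  have hr : row 2 (o, a₁, a₂, a₃, b) = (sep [a₁] [a₂, a₃], sep [a₁] [b], sep [a₂, a₃] [b]) := rfl
  unfold RowHolds
  rw [hr, e3Ineq_iff_sahiE3_nonneg]
  exact sahiE3_sep_nonneg w [a₁] [a₂, a₃] b

/-- **Row `E3GRPb` 1 on EVERY finite weighted graph**: `E₃(D[o|a₁a₂], D[o|a₃b], D[a₁a₂|a₃b]) ≥ 0` (prim-ineq-gen-8's second
family, not among the nine `row`s) — `GRP3PTLB` with the vertex `o` and the sets `{a₁,a₂}`, `{a₃,b}`. [this work] -/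
theorem e3GRPb_one_all (w : Sym2 (Fin n) → unitInterval) (o a₁ a₂ a₃ b : Fin n) :
    E3Ineq w (sep [o] [a₁, a₂]) (sep [o] [a₃, b]) (sep [a₁, a₂] [a₃, b]) := by
  rw [e3Ineq_iff_sahiE3_nonneg]
  exact sahiE3_sep_nonneg' w o [a₁, a₂] [a₃, b]

end E3GroupSepCert

end Summit.CriticalPhenomena.PercolationContinuityZ3.Theorems

end
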